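import Summits.QuantumFields.BalabanUV.T4Continuum.Support.NE7SliceGaugeLetters
import HarnessLib

/-!
# NE7GaugeActChartTransfer — A PERIODIC UNITARY GAUGE MAPS CHART CONFIGURATIONS TO CHART CONFIGURATIONS OF THE SAME SIZE (ROAD-G114 §10 letter): for unitary `M`-periodic `t` and
# a base `W`, `t·(chart_W Φ) = chart_{t·W} Φ′` with `Φ′(r, κ) = Ad_{t(boxVec r + e_κ)} Φ(r, κ)` skew and `‖Φ′‖ ≤ ‖Φ‖` (transfer of the Lipschitz copies of ✓ p823122 from one
# minimiser over `V₀` to another, and conjugation of copies by constant stabilisers)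

Cell `pub-balaban`, rung (B)+1 sub-cell t4, lineage `b2b-balaban-t4-ne7-p1` (CRUX PROVER NE7 #1 = OWNER of BINDER row NE7), generation 114.  Memo `t4/b2b-balaban-t4-ne7-p1-g114/ROAD-G114.md` §10.
WHAT ([folklore]; 0 def, 0 sorry).  **`gaugeAct_chart_transfer`**.
HONEST FRAMING (page 1): an elementary letter; nothing of Bałaban's; NOT NE7, NOT NE3; spine 0∕9; finite T⁴ rung (B)+1 — NOT infinite volume, NOT mass gap, NOT BetaPertH, NOT Clay.
-/

set_option autoImplicit false

open scoped BigOperators Matrix Matrix.Norms.L2Operator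
open NormedSpace Finset Set

namespace Summit.QuantumFields.BalabanUV.T4Continuum.NE7GaugeActChartTransfer

open Literature.MathematicalPhysics.QuantumFieldTheory.Balaban1983to89
open B7Prop1Explicit B7Prop2Explicit
open AveragingDeficitTorusChart (TDir chart chartDir redN eq_wrap_add periodic_smul_vec)
open AveragingDeficitTwoLevelPrep (skewSub mem_skewSub)
open NE3EnergyShapes (IsUnitarySite IsPeriodicSite)
open NE7DatumCoordinateStabiliser (inv_mem_unitary)

noncomputable section

variable {n : Type} [Fintype n] [DecidableEq n]

/-- **`t·(chart_W Φ) = chart_{t·W} Φ′`, `‖Φ′‖ ≤ ‖Φ‖** for a unitary `M`-periodic gauge `t` (the chart parameter is conjugated bondwise by the end-point value of `t`). [folklore] -/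
theorem gaugeAct_chart_transfer [Nonempty n] {M : ℕ} [NeZero M] {t : Site 4 → (Matrix n n ℂ)ˣ} (htu : IsUnitarySite t) (htP : IsPeriodicSite t (M : ℤ))
    (W : Site 4 → Fin 4 → (Matrix n n ℂ)ˣ) (Φ : ↥(skewSub 4 n M)) :
    ∃ Φ' : ↥(skewSub 4 n M), gaugeAct t (chart (ContinuousLinearMap.id ℝ (Matrix n n ℂ)) M W (Φ : TDir 4 n M))
        = chart (ContinuousLinearMap.id ℝ (Matrix n n ℂ)) M (gaugeAct t W) (Φ' : TDir 4 n M) ∧ ‖Φ'‖ ≤ ‖Φ‖ := by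
  letI : CStarAlgebra (Matrix n n ℂ) := {}
  letI : NormedAlgebra ℚ (Matrix n n ℂ) := NormedAlgebra.restrictScalars ℚ ℂ (Matrix n n ℂ)
  have hst : ∀ c : (Matrix n n ℂ)ˣ, c ∈ unitaryUnits (Matrix n n ℂ) → ((c⁻¹ : (Matrix n n ℂ)ˣ) : Matrix n n ℂ) = star (c : Matrix n n ℂ) := fun c hc =>
    Units.inv_eq_of_mul_eq_one_left (Unitary.star_mul_self_of_mem (mem_unitaryUnits.mp hc))
  set Ψ : TDir 4 n M := fun r κ => (t (boxVec M r + e κ) : Matrix n n ℂ) * (Φ : TDir 4 n M) r κ * (((t (boxVec M r + e κ))⁻¹ : (Matrix n n ℂ)ˣ) : Matrix n n ℂ)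
    with hΨ
  have hΨskew : ∀ r κ, Ψ r κ ∈ skewAdjoint (Matrix n n ℂ) := fun r κ => by
    simp only [hΨ]; rw [hst _ (htu _)]
    exact skewAdjoint.conjugate ((mem_skewSub.mp Φ.2) r κ) _
  have hP : ∀ (x : Site 4) (κ : Fin 4), t (x + e κ) = t (boxVec M (redN M x) + e κ) := fun x κ => by
    conv_lhs => rw [eq_wrap_add M x, add_right_comm]
    exact periodic_smul_vec htP _ _
  refine ⟨⟨Ψ, mem_skewSub.mpr hΨskew⟩, ?_, ?_⟩
  · funext x κ
    apply Units.ext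
    simp only [gaugeAct, chart, chartDir, Units.val_mul, val_expUnit, ContinuousLinearMap.id_apply]
    rw [show Ψ (redN M x) κ = (t (boxVec M (redN M x) + e κ) : Matrix n n ℂ) * (Φ : TDir 4 n M) (redN M x) κ
      * (((t (boxVec M (redN M x) + e κ))⁻¹ : (Matrix n n ℂ)ˣ) : Matrix n n ℂ) from rfl, ← hP, NormedSpace.exp_units_conj]
    rw [show ∀ A B C D E : Matrix n n ℂ, A * B * C * (D * E * C) = A * (B * (C * D) * E) * C from fun A B C D E => by noncomm_ring, Units.inv_mul, mul_one]
  · refine (pi_norm_le_iff_of_nonneg (norm_nonneg _)).mpr fun r => (pi_norm_le_iff_of_nonneg (norm_nonneg _)).mpr fun κ => ?_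
    show ‖Ψ r κ‖ ≤ ‖Φ‖
    simp only [hΨ]
    rw [CStarRing.norm_mul_mem_unitary _ (inv_mem_unitary (htu _)), CStarRing.norm_mem_unitary_mul _ (mem_unitaryUnits.mp (htu _)), Submodule.coe_norm]
    exact (norm_le_pi_norm ((Φ : TDir 4 n M) r) κ).trans (norm_le_pi_norm _ _)

end

end Summit.QuantumFields.BalabanUV.T4Continuum.NE7GaugeActChartTransfer
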